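import Summits.BirchSwinnertonDyer.BirchSwinnertonDyer.Theorems.GoldfeldAllTwistsTwoConverseTwinGenusRankOne
import Summits.BirchSwinnertonDyer.BirchSwinnertonDyer.Theorems.GoldfeldAllTwistsTwoConverseTwinGenusRankOneRatNegTwo
import Summits.BirchSwinnertonDyer.BirchSwinnertonDyer.Theorems.GoldfeldAllTwistsTwoConverseTwinGenusRankOneDescentNegTwo
import HarnessLib

set_option linter.dupNamespace false
set_option autoImplicit false

/-!
# LINE B49, genus assembly, family F2 (`d_K = −8q`), step W-A2′ part II(b): (RO′) — the genus point `P_χ` against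
# the point `(−2, 1 + 2θ₀)` (`θ₀² = −2`) over the Hilbert class field, from the `K/ℚ` step (part I′), descent to the
# genus field `K(θ₀)` (part II′(a)) and the twist by `θ₀` onto the `3136⁻`-curve

Cell `bsd-goldfeld`, seat `bsd-goldfeld-s1p-c3` (prover, gen 8); memo `HOME/B49-GENUS.md` §1 (family F2), the F2
analogue of `…TwinGenusRankOne` (family F1: `(0, i)`, twist by `i` onto `784`). Support for item
`stmt-BirchSwinnertonDyer-19140` (crux twin″; joint with 20044 K12₂″). Theorems only. HONEST FRAMING: BSD is not
proved by any of this; printed input: CLTZ 2015 Thm 1.2 (`h12`), via part I′.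

THE ARGUMENT (as in F1). `K` imaginary quadratic, `d_K = −8q`, `q ≡ 1 (mod 4)`; `L/K` finite Galois, `r₀ ∈ L` with
`r₀² = q`, `y₁ ∈ X₀(49)(L)`; `P_χ = Σ_σ χ(σ)•σy₁`. (1)–(2) Part II′(a) (`exists_genusField_data_negEight`): `P_χ`
descends to `y_χ ∈ X₀(49)(H₀)`, `H₀ = K(r₀) = K(θ₀)`, `θ₀² = −2`, negated by the conjugation `σ₀` of `H₀/K`. (3) On
the completed-square model `y_χ = τ_θ(R)` for a `K`-point `R` of the twist by `−2` = the `3136⁻`-curve (tree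
`QuadraticDescent`, gen 7's `exists_twistMap_eq_of_conjMap_eq_neg`), and `τ_θ((4, 8)) = (−2, 2θ₀) =` the
completed-square image of `(−2, 1 + 2θ₀) ∈ X₀(49)(H₀)` (`τ(X, Y) = (θ⁻²X, θ⁻³Y)`). (4) Part I′
(`exists_odd_two_mul_zsmul_sub_incl_fourEight`): `(2n)•R − a•(4,8)` torsion with `n` odd; push through `τ_θ`, the
completing-square isomorphism and `H₀ → L`. Result: `exists_oddIndex_twistedSum_negEight` (abstract `L`) and, at
`L = K[1]`, `y₁ = d.y`, the (RO′) input `x049GenusNegEight_hRO` of the F2 Theorem A′ (the point `(−2, y)` has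
infinite order by the height transport `canonicalHeight_negTwo_cm7_ne_zero`, so no `α`-descent is needed here).

References: J. Coates, Y. Li, Y. Tian, S. Zhai, PLMS 110 (2015) Thm 1.2, (2.8) [CoatesLiTianZhai2015]; J. H.
Silverman, AEC (2009) X.2, X.5 Cor. 5.4, Ex. 10.16 [SilvermanAEC2009]; B. Gross (1984) §§4–5 [Gross1984].
-/

noncomputable section

open scoped Classical IntermediateField

open WeierstrassCurve Literature.NumberTheory.EllipticCurves
  Literature.NumberTheory.EllipticCurves.ModularForms

namespace Summit.BirchSwinnertonDyer.BirchSwinnertonDyer.Theorems.GoldfeldGoodTwists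

/-! ## §3′ The twist by `θ₀` over the genus field and the assembly of (RO′) -/

section TwistNegTwo

-- Same decidability world as `…TwinGenusRankOne` / part I′ (classical at top priority), so that the tree's generic
-- `QuadraticDescent` lemmas, part I′ and gen 7's transport lemmas apply verbatim.
attribute [local instance 2000] Classical.propDecidable

variable {K : Type} [Field K] [NumberField K]

/-- `(cm7 ⊗ K)^{(−2)} = ((cm7^{(−2)})^{(1)}) ⊗ K` — the `3136⁻`-curve of part I′ read over `K`.
[cite: SilvermanAEC2009, X.2 Prop. 2.4] -/
theorem cm7_baseChange_quadraticTwist_neg_two (K : Type) [Field K] [NumberField K] :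
    (cm7.baseChange K).quadraticTwist (-2) = ((cm7.quadraticTwist (-2)).quadraticTwist 1).baseChange K := by
  rw [quadraticTwist_neg_two_quadraticTwist_one, baseChange, baseChange, map_quadraticTwist, map_neg, map_ofNat]

variable {L : Type*} [Field L] [CharZero L] [Algebra K L] [FiniteDimensional K L] [IsGalois K L]

/-- **(RO′) for an abstract Galois extension `L/K` (family F2)**: for `K` imaginary quadratic with `d_K = −8q`
(`q ≡ 1 (mod 4)` prime, `(q/7) = −1`), `L/K` finite Galois, `r₀ ∈ L` with `r₀² = q`, and any `y₁ ∈ X₀(49)(L)`, there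
are `y ∈ L` with `(−2, y) ∈ X₀(49)(L)`, an ODD `n` and `a ∈ ℤ` with `(2n) • P_χ − a • (−2, y)` torsion,
`P_χ = Σ_σ χ(σ)•σy₁`. Granted CLTZ 2015 Thm 1.2 (`h12`). [cite: CoatesLiTianZhai2015, Thm. 1.2 (p. 359)]
[cite: SilvermanAEC2009, X.2 Prop. 2.4, Ex. 10.16] [cite: Gross1984, §§4–5] -/
theorem exists_oddIndex_twistedSum_negEight (h12 : CoatesLiTianZhai2015.thm12_fullBSD_twist)
    (hK : IsImaginaryQuadratic K) {q : ℕ} (hq : q.Prime) (hq4 : q % 4 = 1) (hq7 : jacobiSym q 7 = -1)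
    (hdK : NumberField.discr K = -(8 * (q : ℤ))) {r₀ : L} (hr : r₀ ^ 2 = algebraMap K L ((q : ℕ) : K))
    (y₁ : (cm7.baseChange L).toAffine.Point) :
    ∃ (y : L) (hy : (cm7.baseChange L).toAffine.Nonsingular (-2) y) (n a : ℤ), Odd n ∧
      IsOfFinAddOrder ((2 * n) • (∑ σ : L ≃ₐ[K] L, (if σ r₀ = r₀ then (1 : ℤ) else -1) •
          Affine.Point.map (σ : L →ₐ[K] L) y₁) - a • Affine.Point.some (-2) y hy) := by
  obtain ⟨θ₀, hfin, hθ, hi, yχ, hiL2, hyχ, hanti⟩ := exists_genusField_data_negEight hK hq hdK hr y₁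
  have hi₀2 : θ₀ ^ 2 = -2 := by rw [hi]; simp [map_ofNat]
  have hθ0 : θ₀ ≠ 0 := Literature.NumberTheory.QuadraticFields.Quadratic.ne_zero_of_not_mem_range hθ
  -- the point `G₀ = (−2, 1 + 2θ₀) ∈ X₀(49)(H₀)`
  have hg : (cm7.baseChange K⟮r₀⟯).toAffine.Nonsingular (-2) (1 + 2 * θ₀) := by
    refine (Affine.equation_iff_nonsingular).mp ?_
    rw [Affine.equation_iff]
    simp [baseChange]
    linear_combination 4 * hi₀2
  -- the completing-square transport `e : X₀(49)(H₀) ≃ (cm7 ⊗ K)^{(1)}(H₀)`, natural in `Gal(H₀/K)`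
  have hbb : (cm7.baseChange K).baseChange K⟮r₀⟯ = cm7.baseChange K⟮r₀⟯ :=
    cm7.map_baseChange (IsScalarTower.toAlgHom ℚ K K⟮r₀⟯)
  have hC := completeSquare_smul_cm7_baseChange K
  let e₀ : (cm7.baseChange K⟮r₀⟯).toAffine.Point ≃+ ((cm7.baseChange K).baseChange K⟮r₀⟯).toAffine.Point :=
    Affine.Point.congrEquiv hbb.symm
  let e₁ := VariableChange.pointEquivBaseChange (cm7.baseChange K)
    (((⟨1, 0, -(1 / 2 : ℚ), 0⟩ : VariableChange ℚ).map (algebraMap ℚ K))) K⟮r₀⟯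
  let e₂ := Affine.Point.congrEquiv (congrArg (fun X : WeierstrassCurve K => X.baseChange K⟮r₀⟯) hC)
  let e := e₀.trans (e₁.trans e₂)
  -- the conjugation `σ₀` of `H₀/K`
  have hσ : ∀ P : (cm7.baseChange K⟮r₀⟯).toAffine.Point,
      Affine.Point.map (W' := (cm7.baseChange K).quadraticTwist 1)
          (Literature.NumberTheory.QuadraticFields.Quadratic.conj hfin hθ hi) (e P) =
        e (Affine.Point.map (W' := cm7) (Literature.NumberTheory.QuadraticFields.Quadratic.conj hfin hθ hi) P) := by
    intro P
    have h0 : ∀ Q : (cm7.baseChange K⟮r₀⟯).toAffine.Point,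
        Affine.Point.map (W' := cm7.baseChange K)
            (Literature.NumberTheory.QuadraticFields.Quadratic.conj hfin hθ hi) (e₀ Q) =
          e₀ (Affine.Point.map (W' := cm7) (Literature.NumberTheory.QuadraticFields.Quadratic.conj hfin hθ hi) Q) := by
      intro Q
      rcases Q with _ | ⟨x, y, hxy⟩
      · simp [e₀, Affine.Point.congrEquiv_zero, ← Affine.Point.zero_def]
      · simp only [e₀, Affine.Point.congrEquiv_some, Affine.Point.map_some]
    show Affine.Point.map _ (e₂ (e₁ (e₀ P))) = e₂ (e₁ (e₀ (Affine.Point.map _ P)))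
    rw [← h0, ← VariableChange.pointEquivBaseChange_map]
    exact map_congrEquiv_baseChange hC _ _
  have hanti' : QuadraticDescent.conjMap ((cm7.baseChange K).quadraticTwist 1)
      (Literature.NumberTheory.QuadraticFields.Quadratic.conj hfin hθ hi) (e yχ) = -(e yχ) := by
    have hanti₂ : Affine.Point.map (W' := cm7)
        (Literature.NumberTheory.QuadraticFields.Quadratic.conj hfin hθ hi) yχ = -yχ := by
      rcases yχ with _ | ⟨x, y, hxy⟩
      · rfl
      · exact hanti
    have h1 := hσ yχ
    rw [hanti₂, map_neg] at h1
    exact h1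
  -- the twist: `e yχ = τ(R)` for a `K`-point `R` of `(cm7 ⊗ K)^{(−2)}` (the `3136⁻`-curve)
  obtain ⟨R, hR⟩ := exists_twistMap_eq_of_conjMap_eq_neg (cm7.baseChange K) hfin hθ hi hanti'
  -- part I′ on `R`, read on `(cm7 ⊗ K)^{(−2)}`
  let κ : ((cm7.baseChange K).quadraticTwist (-2)).toAffine.Point ≃+
      (((cm7.quadraticTwist (-2)).quadraticTwist 1).baseChange K).toAffine.Point :=
    Affine.Point.congrEquiv (cm7_baseChange_quadraticTwist_neg_two K)
  haveI : ((cm7.baseChange K).quadraticTwist (-2)).IsElliptic := by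
    haveI : (cm7.baseChange K).IsElliptic := by rw [WeierstrassCurve.baseChange]; infer_instance
    exact (cm7.baseChange K).isElliptic_quadraticTwist (by norm_num)
  have hR48 : ((cm7.baseChange K).quadraticTwist (-2)).toAffine.Nonsingular 4 8 := by
    refine (Affine.equation_iff_nonsingular).mp ?_
    rw [Affine.equation_iff]
    simp [quadraticTwist, baseChange, b₂, b₄, b₆]
    norm_num
  obtain ⟨n, a, hn, hT⟩ := exists_odd_two_mul_zsmul_sub_incl_fourEight h12 hK hq hq4 hq7 hdK (κ R)
  have hκG : κ (Affine.Point.some 4 8 hR48) = QuadraticDescent.incl K ((cm7.quadraticTwist (-2)).quadraticTwist 1)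
      (Affine.Point.some 4 8 nonsingular_twist3136_one_four_eight) := by
    simp only [κ, Affine.Point.congrEquiv_some]
    erw [Affine.Point.map_some]
    simp only [map_ofNat]
  have hT' : IsOfFinAddOrder ((2 * n) • R - a • Affine.Point.some 4 8 hR48) := by
    have h := κ.symm.toAddMonoidHom.isOfFinAddOrder hT
    rw [← hκG] at h
    simpa using h
  -- push through the twisting map: `τ(4, 8) = (−2, 2θ₀) = e (−2, 1 + 2θ₀)`
  have hτG : QuadraticDescent.twistMap (cm7.baseChange K) hθ hi (Affine.Point.some 4 8 hR48) =
      e (Affine.Point.some (-2) (1 + 2 * θ₀) hg) := by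
    obtain ⟨h', e'⟩ := QuadraticDescent.twistMap_some (cm7.baseChange K) hθ hi hR48
    rw [e']
    -- the right-hand side
    haveI : ((cm7.baseChange K).quadraticTwist 1).IsElliptic := by
      haveI : (cm7.baseChange K).IsElliptic := by rw [WeierstrassCurve.baseChange]; infer_instance
      exact (cm7.baseChange K).isElliptic_quadraticTwist (by norm_num)
    have hg' : (((cm7.baseChange K).quadraticTwist 1).baseChange K⟮r₀⟯).toAffine.Nonsingular (-2) (2 * θ₀) := by
      haveI : (((cm7.baseChange K).quadraticTwist 1).baseChange K⟮r₀⟯).IsElliptic := by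
        rw [WeierstrassCurve.baseChange]; infer_instance
      refine (Affine.equation_iff_nonsingular).mp ?_
      rw [Affine.equation_iff]
      simp [quadraticTwist, baseChange, b₂, b₄, b₆, map_ofNat]
      linear_combination 4 * hi₀2
    have he : e (Affine.Point.some (-2) (1 + 2 * θ₀) hg) = Affine.Point.some (-2) (2 * θ₀) hg' := by
      show e₂ (e₁ (e₀ _)) = _
      simp only [e₀, e₁, e₂, Affine.Point.congrEquiv_some, VariableChange.pointEquivBaseChange_some]
      congr 1
      · simp [VariableChange.toX_def, VariableChange.map]
      · simp [VariableChange.toY_def, VariableChange.map, map_ofNat]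
    rw [he]
    congr 1
    · simp only [VariableChange.toX_def, twistUntwist, sub_zero, map_ofNat, inv_pow, Units.val_inv_eq_inv_val,
        Units.val_mk0]
      rw [hi₀2]
      norm_num
    · -- `θ₀⁻¹ = −θ₀/2`, so `θ₀⁻³ · 8 = −θ₀³ = 2θ₀` (no `field_simp`: its `decide` side goals clash with the
      -- classical instance at top priority)
      have hinv : θ₀⁻¹ = -θ₀ / 2 :=
        inv_eq_of_mul_eq_one_right (by linear_combination (-1 / 2 : K⟮r₀⟯) * hi₀2)
      simp only [VariableChange.toY_def, twistUntwist, sub_zero, zero_mul, map_ofNat, Units.val_inv_eq_inv_val,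
        Units.val_mk0]
      rw [hinv]
      linear_combination (-θ₀) * hi₀2
  have hS : IsOfFinAddOrder ((2 * n) • yχ - a • Affine.Point.some (-2) (1 + 2 * θ₀) hg) := by
    have h := (QuadraticDescent.twistMap (cm7.baseChange K) hθ hi).isOfFinAddOrder hT'
    rw [map_sub, map_zsmul, map_zsmul, hR, hτG, ← map_zsmul, ← map_zsmul, ← map_sub] at h
    simpa using e.symm.toAddMonoidHom.isOfFinAddOrder h
  -- push to `L`
  have hgL : (cm7.baseChange L).toAffine.Nonsingular (-2) (1 + 2 * (θ₀ : L)) := by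
    refine (Affine.equation_iff_nonsingular).mp ?_
    rw [Affine.equation_iff]
    simp [baseChange]
    linear_combination 4 * hiL2
  have hmapG : Affine.Point.map (W' := cm7) (algebraMap K⟮r₀⟯ L).toRatAlgHom
      (Affine.Point.some (-2) (1 + 2 * θ₀) hg) = Affine.Point.some (-2) (1 + 2 * (θ₀ : L)) hgL := by
    rw [Affine.Point.map_some]
    congr 1
  refine ⟨1 + 2 * (θ₀ : L), hgL, n, a, hn, ?_⟩
  have hyχ₂ : Affine.Point.map (W' := cm7) (algebraMap K⟮r₀⟯ L).toRatAlgHom yχ =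
      ∑ σ : L ≃ₐ[K] L, (if σ r₀ = r₀ then (1 : ℤ) else -1) • Affine.Point.map (σ : L →ₐ[K] L) y₁ := by
    rw [← hyχ]
    rcases yχ with _ | ⟨x, y, hxy⟩ <;> rfl
  have h := (Affine.Point.map (W' := cm7) (algebraMap K⟮r₀⟯ L).toRatAlgHom).isOfFinAddOrder hS
  rw [map_sub, map_zsmul, map_zsmul, hyχ₂, hmapG] at h
  exact h

/-! ## §4′ At `L = K[1]`, `y₁ = y(1)`: the (RO′) input of the F2 Theorem A′ -/

/-- **(RO′) at the Hilbert class field (family F2), PROVED** granted Coates–Li–Tian–Zhai 2015 Thm 1.2 (`h12`): for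
every datum `D₀` of `X₀(49)` (any level `N`, any Manin multiplier), every prime `q ≡ 1 (mod 4)` with `(q/7) = −1`,
every imaginary quadratic `K` with `d_K = −8q`, every `ι`, `β`, conductor-one Kolyvagin–Heegner datum `d` and
`r₀ ∈ K[1]` with `r₀² = q`: there are `(−2, y) ∈ X₀(49)(K[1])`, an ODD `n` and `a ∈ ℤ` with
`(2n) • P_χ − a • (−2, y)` torsion, `P_χ = Σ_{s ∈ 𝒢₁} χ(s)·s y(1)` (§3′ at `L = K[1]`, `y₁ = d.y`, reindexed by
`sum_S_eq_sum_algEquiv`). [cite: CoatesLiTianZhai2015, Thm. 1.2 (p. 359)] [cite: GrossLMS1991, §§3–4 (4.1)] [cite: Gross1984, §§4–5] -/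
theorem x049GenusNegEight_hRO (h12 : CoatesLiTianZhai2015.thm12_fullBSD_twist) {N : ℕ} [NeZero N]
    (D₀ : ModularParametrizationData cm7 N) {q : ℕ} (hq : q.Prime) (hq4 : q % 4 = 1) (hq7 : jacobiSym q 7 = -1)
    (hK : IsImaginaryQuadratic K) (hdK : NumberField.discr K = -(8 * (q : ℤ))) (ι : K →+* ℂ) {β : ℤ}
    (d : KolyvaginHeegnerData D₀ β ι 1) (r₀ : ringClassField K ι 1) (hs : (r₀ : ℂ) ^ 2 = (q : ℂ)) :
    ∃ (y : ringClassField K ι 1) (hy : (cm7.baseChange (ringClassField K ι 1)).toAffine.Nonsingular (-2) y)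
      (n a : ℤ), Odd n ∧
      IsOfFinAddOrder ((2 * n) • (∑ s ∈ d.S, (if s r₀ = r₀ then (1 : ℤ) else -1) •
          pointGalHom cm7 (ringClassField K ι 1) s d.y) - a • Affine.Point.some (-2) y hy) := by
  haveI := (finiteDimensional_and_isGalois_ringClassField hK ι one_ne_zero).1
  haveI := (finiteDimensional_and_isGalois_ringClassField hK ι one_ne_zero).2
  have hr : r₀ ^ 2 = algebraMap K (ringClassField K ι 1) ((q : ℕ) : K) := by
    apply Subtype.ext
    rw [map_natCast]
    simpa using hs
  obtain ⟨y, hy, n, a, hn, hT⟩ := exists_oddIndex_twistedSum_negEight h12 hK hq hq4 hq7 hdK hr d.y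
  refine ⟨y, hy, n, a, hn, ?_⟩
  rw [sum_S_eq_sum_algEquiv d]
  exact hT

end TwistNegTwo

end Summit.BirchSwinnertonDyer.BirchSwinnertonDyer.Theorems.GoldfeldGoodTwists

end
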